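import Summits.QuantumFields.YangMills.Theorems.BalabanUVNodesK0FlatCubeOpsTextP
import Summits.QuantumFields.YangMills.Theorems.UnitScaleTiltProp8FlatCubeOperators
import Literature.MathematicalPhysics.QuantumFieldTheory.Balaban1983to89.B6GOmegaMarginV1
import HarnessLib

/-!
# K0 road ([15] = [Balaban1985Variational] Sect. F, (157)–(159)) — **THE FLAT-CUBE MINIMISER `H = GQ*(QGQ*)⁻¹` IS EXACTLY LOCAL WITH RESPECT TO PINNED LEVEL-0 CELLS**:
# `H(X + Qδ) = HX + δ` for every fine perturbation `δ` with `Δ_a δ ∈ range Q*`, and `Δ_a δ ∈ range Q*` whenever `δ` is supported on level-0 cells whose plaquette- and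
# site-stencils consist of level-0 cells — so the values of `H X` off a far pinned region do NOT depend on `X` there (⚑ LOCATED-PINNED-EXTERIOR, cell bus 2026-08-29)

Cell `pub-ymgap`, seat `pub-ymgap-dag-n07-e` g25 (FAN-OUT §N07 row s3; LANE OWNER of the K0 road), MODULE 76 (INTENT-76, cell bus).  `--kind proof --supports stmt-QuantumFields-20541 --as helper`
(K0⁷); count-neutral; def-free; generic `P : Params`, `D : Domains P`.  [15] = [Balaban1985Variational]; [4] = [Balaban1984PropagatorsII].

WHY (the located point).  The knit of record's HCHART-MEET-NORM (MODULE 67c) asks the chart for rows `‖B c‖ ≤ β₂·(ρ + sideP)` at EVERY index bond `c` of the meet family `D″` — whose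
level-0 cells are all fine bonds with no end under `Ω₁` on the WHOLE torus (`cubeDomains_Om_zero = univ`) — and for the split `A = A₁ + H_V B − H_V B′` with `A₁`'s letters on the
print box; HS3NORM displays `(u, A)` on the tower window `□₀` only.  `B` is existential, so the chart may set `B = B′ = 0` at far pinned cells and `A₁ := A` there — provided
`H_V`'s values on the print box do not depend on the far entries AT ALL (a mere kernel decay would let the unconstrained far `A` leak into `A₁`'s print-box letters).  THIS FILE proves
that exact independence from [4]'s structure alone: `H = GQ*(QGQ*)⁻¹` ((2.35), `K0FlatCubeOpsTextP.flatH`) is the UNIQUE constrained critical point (`QA = X`, `Δ_aA ∈ range Q*`;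
positivity of `Δ_a = ∂*∂ + ∂R∂* + Q*aQ`, (2.19)–(2.22)), hence `H(X + Qδ) = HX + δ` once `Δ_aδ ∈ range Q*`; and `Δ_aδ ∈ range Q*` for `δ` supported on PINNED bonds: `∂*∂δ` lives
on the plaquette stencil (level-0 cells = `range Q*` there), `R∂*δ = 0` because every `n ∈ ker Q′` vanishes at level-0 cell sites so `Δn = 0` on `δ`'s site stencil ((2.12),
`RE_eq_zero_iff`), `Q*aQδ ∈ range Q*` trivially.  No analysis; no new definition.

WHAT IS PROVED (sorry-free; axioms standard; every hypothesis displayed).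
* §1 ★ `eq_hOp_of_QE_eq_of_deltaAE_mem_range` — uniqueness of the constrained critical point: `QE A = X ∧ Δ_a A ∈ range QsE ⇒ A = H X` (`H = hOp (GE D) (QsE D) (EE D)`, any
  lattice factor `c ≠ 0`, any weights `w > 0`; `QHX = X` and `Δ_aHX = Q*((QGQ*)⁻¹X)` are ym3-torus' `FlatCubeOperators.QE_hOp ∕ deltaAE_hOp`, CONSUMED BY NAME).
* §2 ★★★ `hOp_add_QE` — `H(X + QE δ) = H X + δ` whenever `Δ_a δ ∈ range QsE`; `flatH_apply` (NODE 00's plain-function `flatH P k D` unfolded, `rfl`), ★★ `flatH_add_eq` — the same for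
  `flatH P k D` (lattice factor `Lᵏ`, `a ≡ 1`).
* §3 the support criterion: `QsE_single_levelZero` (`Q*` of the unit vector at a level-0 index is the unit vector at its bond), `mem_range_QsE_of_support_lamBond_zero` (a fine field
  supported on level-0 cells lies in `range Q*`), `apply_eq_zero_of_mem_ker_QpE` (`n ∈ ker Q′` vanishes at level-0 cell sites), ★ `RE_dsE_eq_zero_of_pinned_sites` (`R∂*δ = 0`),
  `dcsE_dcE_apply`, ★ `dcsE_dcE_apply_eq_zero_of_not_stencil` (`∂*∂δ` vanishes off `δ`'s plaquette stencil), ★★ `deltaAE_mem_range_QsE_of_pinned` (the criterion), ★★★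
  `flatH_add_eq_of_pinned` (§2 ∘ §3: the exact locality in the letters a chart pen consumes), `flatH_eq_of_pinned_off_support` (off `δ`'s support `flatH` does not move).
* §4 (v1.1, append-only) THE KERNEL FORM: `ofLp_QE_single_of_tubeFree`, ★★★ `flatH_single_apply_of_pinned` (`flatH (r·𝟙_{⟨0,b₀⟩}) = r·𝟙_{b₀}` for a far pinned cell `b₀`: plaquette ∕ site
  stencils of level-0 cells and no higher averaging tube through `b₀`), `flatH_single_apply_eq_zero_of_pinned` — in the head's `H_V Bf b = Σ_c flatH(𝟙_c) b • Bf c` the far pinned cells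
  contribute nothing off themselves.
* §5 (v1.2, append-only) `tubeFree_of_far` (the tube hypothesis of §4 from geometry: the ancestors of `b₀.src` avoid every `Ω_j^{(j)}` and its forward neighbours, `j ≥ 1`;
  `B6GOmegaMarginV1.bondAvgIter_eq_zero_of_local`), ★★★ `flatH_single_apply_eq_zero_of_far` (the kernel vanishing with all three hypotheses geometric).

HONEST SCOPE.  Pure linear algebra over [4] Sect. 2's operators as typed in `B6SectAOperatorsV1` ∕ `B6SectAVectorModelV1`; the «far ∕ pinned» geometry is DISPLAYED as support hypotheses
on `δ` (the chart pen discharges them from the margins `ρ ≥ L·M_h` of `□₀` over `□₁`); nothing of [15]'s analysis; HS3NORM ∕ HCHART-MEET-NORM ∕ HBUDGET-NORM untouched; K0⁷ ∕ K1⁹ NOT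
closed; N07 NOT discharged, NOT claimable on road (β); counts unmoved (28∕28 · 7∕28); one finite 𝕋⁴ programme at fixed ε — the route closes the conditional finite-𝕋⁴ rung
`BalabanLadder.UV` only; the YM mass gap (Clay) is NOT proved by any of this; nothing continuum ∕ ℝ⁴ ∕ OS.  No `sorry`, no `def`, no `instance`, no `notation`.

References: [4] (2.3) p. 224, (2.6)–(2.12) pp. 224–225, (2.18)–(2.22) p. 226, (2.35) p. 228; [15] (157)–(159) p. 302, (162) p. 303.
-/

set_option autoImplicit false

noncomputable section

namespace Summit.QuantumFields.YangMills.Theorems.K0FlatHPinnedExteriorLocality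

open scoped InnerProductSpace Classical
open Literature.MathematicalPhysics.QuantumFieldTheory.Balaban1983to89
open B6SectADomainsV1 B6SectAOperatorsV1 B6SectAVectorModelV1 LatticeFieldCalculus
open B6SectA (hOp)
open Literature.MathematicalPhysics.QuantumFieldTheory.BalabanImbrieJaffe1984to88.BIJ85AxialPropagator411 (BondSpace PlaqSpace)
open Summit.QuantumFields.YangMills.Theorems.K0FlatCubeOpsTextP (flatH)
open Summit.QuantumFields.YangMills.Theorems.FlatCubeOperators (QE_hOp deltaAE_hOp)

variable {P : Params} (D : Domains P)

/-! ## §1  Uniqueness of the constrained critical point -/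

section Uniqueness

variable {c : ℝ} (hc : c ≠ 0) {w : BondIdx D → ℝ} (hw : ∀ i, 0 < w i)

include hc hw in
/-- ★ **UNIQUENESS OF THE CONSTRAINED CRITICAL POINT**: if `QA = X` and `Δ_aA ∈ range Q*` then `A = HX` — the difference `A − HX` has zero constraints and `Δ_a`-image in `range Q*`, so
`⟨A − HX, Δ_a(A − HX)⟩ = ⟨Q(A − HX), ·⟩ = 0` and positivity (2.19)–(2.22) gives `A − HX = 0`. [cite: Balaban1984PropagatorsII, (2.21)–(2.22) p.226, (2.35) p.228] -/
theorem eq_hOp_of_QE_eq_of_deltaAE_mem_range {A : BondSpace P} {X : BondIdxSpace D} (hQ : QE D A = X)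
    (hΔ : deltaAE D c w A ∈ LinearMap.range (QsE D)) : A = hOp (GE D hc hw) (QsE D) (EE D hc hw) X := by
  obtain ⟨ω, hω⟩ := hΔ
  set A₀ := hOp (GE D hc hw) (QsE D) (EE D hc hw) X with hA₀
  have hQ0 : QE D (A - A₀) = 0 := by rw [map_sub, hQ, QE_hOp, sub_self]
  have hΔ0 : deltaAE D c w (A - A₀) = QsE D (ω - EE D hc hw X) := by rw [map_sub, ← hω, deltaAE_hOp, map_sub]
  have hinner : ⟪A - A₀, deltaAE D c w (A - A₀)⟫_ℝ = 0 := by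
    rw [hΔ0, real_inner_comm, inner_QsE_left, hQ0, inner_zero_right]
  have h := eq_zero_of_inner_deltaAE_self_eq_zero D hc hw hinner
  exact sub_eq_zero.mp h

end Uniqueness

/-! ## §2  `H(X + Qδ) = HX + δ` for `Δ_aδ ∈ range Q*` -/

section Shift

variable {c : ℝ} (hc : c ≠ 0) {w : BondIdx D → ℝ} (hw : ∀ i, 0 < w i)

include hc hw in
/-- ★★★ **EXACT LOCALITY OF `H` UNDER RANGE-`Q*` PERTURBATIONS**: for every constraint datum `X` and every fine field `δ` with `Δ_aδ ∈ range Q*`, `H(X + Qδ) = HX + δ` — the field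
`HX + δ` has constraints `X + Qδ` and `Δ_a`-image in `range Q*`, so §1 applies. [cite: Balaban1984PropagatorsII, (2.21)–(2.22) p.226, (2.35) p.228] -/
theorem hOp_add_QE (X : BondIdxSpace D) {δ : BondSpace P} (hδ : deltaAE D c w δ ∈ LinearMap.range (QsE D)) :
    hOp (GE D hc hw) (QsE D) (EE D hc hw) (X + QE D δ) = hOp (GE D hc hw) (QsE D) (EE D hc hw) X + δ := by
  symm
  refine eq_hOp_of_QE_eq_of_deltaAE_mem_range D hc hw ?_ ?_
  · rw [map_add, QE_hOp]
  · rw [map_add, deltaAE_hOp]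
    exact Submodule.add_mem _ (LinearMap.mem_range_self _ _) hδ

end Shift

section Plain

variable (P) (k : ℕ)

/-- `flatH` unfolded at a bond: `flatH X b = (H (toLp X)) b` with `H = hOp (GE D) (QsE D) (EE D)` at lattice factor `Lᵏ`, weights `a ≡ 1` (definitional).
[cite: Balaban1984PropagatorsII, (2.35) p.228; Balaban1985Variational, (157) p.302] -/
theorem flatH_apply (X : BondIdx D → ℝ) (b : PBond P 0) :
    flatH P k D X b =
      (hOp (GE D (c := (P.L : ℝ) ^ k) (pow_ne_zero _ (Nat.cast_ne_zero.2 P.L_pos.ne')) (w := fun _ => (1 : ℝ)) (fun _ => one_pos))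
        (QsE D) (EE D (c := (P.L : ℝ) ^ k) (pow_ne_zero _ (Nat.cast_ne_zero.2 P.L_pos.ne')) (w := fun _ => (1 : ℝ)) (fun _ => one_pos))
        (WithLp.toLp 2 X)) b := rfl

/-- ★★ **THE SAME FOR NODE 00's PLAIN-FUNCTION `flatH`** (`K0FlatCubeOpsTextP.flatH P k D`: lattice factor `Lᵏ`, weights `a ≡ 1`): for plain functions `X : BondIdx D → ℝ` and
`δ : PBond P 0 → ℝ` with `Δ_a(δ) ∈ range Q*`, `flatH (X + Qδ) b = flatH X b + δ b` at every fine bond `b`. [cite: Balaban1984PropagatorsII, (2.35) p.228; Balaban1985Variational, (157) p.302] -/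
theorem flatH_add_eq (X : BondIdx D → ℝ) (δ : PBond P 0 → ℝ)
    (hδ : deltaAE D ((P.L : ℝ) ^ k) (fun _ => (1 : ℝ)) (WithLp.toLp 2 δ) ∈ LinearMap.range (QsE D)) (b : PBond P 0) :
    flatH P k D (X + WithLp.ofLp (QE D (WithLp.toLp 2 δ))) b = flatH P k D X b + δ b := by
  have hL : ((P.L : ℝ) ^ k) ≠ 0 := pow_ne_zero _ (Nat.cast_ne_zero.2 P.L_pos.ne')
  rw [flatH_apply, flatH_apply, WithLp.toLp_add, WithLp.toLp_ofLp, hOp_add_QE D hL (fun _ => one_pos) (WithLp.toLp 2 X) hδ]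
  rfl

end Plain

/-! ## §3  The support criterion: perturbations on pinned level-0 cells are range-`Q*` perturbations -/

section Support

/-- `Q*` of the unit vector at a LEVEL-0 index `⟨0, b⟩` is the unit vector at the fine bond `b` (`Q₀ = id`). [cite: Balaban1984PropagatorsII, (2.6) p.224 («A = B₀ on Λ₀»), (2.20) p.226] -/
theorem QsE_single_levelZero (b : PBond P 0) (hb : D.LamBond 0 b) (r : ℝ) :
    QsE D (EuclideanSpace.single (⟨⟨⟨0, Nat.succ_pos _⟩, b⟩, hb⟩ : BondIdx D) r) = EuclideanSpace.single b r := by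
  refine ext_inner_right ℝ fun y => ?_
  rw [inner_QsE_left, EuclideanSpace.inner_single_left, EuclideanSpace.inner_single_left, QE_apply]
  rfl

/-- A fine field supported on level-0 cells lies in `range Q*`. [cite: Balaban1984PropagatorsII, (2.6) p.224, (2.20) p.226] -/
theorem mem_range_QsE_of_support_lamBond_zero (v : BondSpace P) (hv : ∀ b, v b ≠ 0 → D.LamBond 0 b) : v ∈ LinearMap.range (QsE D) := by
  have hdec : v = ∑ b, (v b) • EuclideanSpace.single b (1 : ℝ) := by
    ext b'
    simp only [WithLp.ofLp_sum, WithLp.ofLp_smul, Finset.sum_apply, Pi.smul_apply, smul_eq_mul, PiLp.ofLp_single,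
      Pi.single_apply, mul_ite, mul_one, mul_zero, Finset.sum_ite_eq, Finset.mem_univ, if_true]
  rw [hdec]
  refine Submodule.sum_mem _ fun b _ => ?_
  by_cases h0 : v b = 0
  · rw [h0, zero_smul]; exact Submodule.zero_mem _
  · refine Submodule.smul_mem _ _ ⟨EuclideanSpace.single (⟨⟨⟨0, Nat.succ_pos _⟩, b⟩, hv b h0⟩ : BondIdx D) 1, ?_⟩
    exact QsE_single_levelZero D b (hv b h0) 1

/-- Every `n ∈ ker Q′` vanishes at a level-0 cell site (`Q′₀ = id`). [cite: Balaban1984PropagatorsII, (2.7) p.224, (2.14) p.225] -/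
theorem apply_eq_zero_of_mem_ker_QpE {n : ScalarSpace P} (hn : n ∈ LinearMap.ker (QpE D)) {x : Site P 0} (hx : D.LamSite 0 x) : n x = 0 := by
  have h := (mem_ker_QpE_iff D n).1 hn 0 x hx
  simpa [siteAvgIter] using h

/-- ★ **`R∂*δ = 0` FOR `δ` WITH A PINNED SITE STENCIL**: if at both ends `x` of every bond carrying `δ`, the site `x` and all its neighbours `x ± e_μ` are level-0 cell sites, then
`R(∂*δ) = 0` — by (2.12) it suffices that `⟨Δn, ∂*δ⟩ = ⟨∂Δn, δ⟩ = 0` for `n ∈ ker Q′`, and `Δn` vanishes at those ends. [cite: Balaban1984PropagatorsII, (2.9)–(2.12) pp.224–225] -/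
theorem RE_dsE_eq_zero_of_pinned_sites (c : ℝ) {δ : BondSpace P}
    (hsite : ∀ b, δ b ≠ 0 → ∀ x, (x = b.src ∨ x = b.tgt) → D.LamSite 0 x ∧ ∀ μ, D.LamSite 0 (x.shift μ) ∧ D.LamSite 0 (x.unshift μ)) :
    RE D c (dsE c δ) = 0 := by
  rw [RE_eq_zero_iff]
  intro n hn
  have hlap : ∀ b, δ b ≠ 0 → ∀ x, (x = b.src ∨ x = b.tgt) → laplace c (WithLp.ofLp n) x = 0 := by
    intro b hb x hx
    obtain ⟨h0, hμ⟩ := hsite b hb x hx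
    simp only [laplace]
    refine Finset.sum_eq_zero fun μ _ => ?_
    have e0 : n x = 0 := apply_eq_zero_of_mem_ker_QpE D hn h0
    have e1 : n (x.shift μ) = 0 := apply_eq_zero_of_mem_ker_QpE D hn (hμ μ).1
    have e2 : n (x.unshift μ) = 0 := apply_eq_zero_of_mem_ker_QpE D hn (hμ μ).2
    simp [e0, e1, e2]
  rw [real_inner_comm, inner_dsE_left, inner_eq_sum]
  refine Finset.sum_eq_zero fun b _ => ?_
  by_cases hb : δ b = 0
  · rw [hb, zero_mul]
  · have hs := hlap b hb b.src (Or.inl rfl)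
    have ht := hlap b hb b.tgt (Or.inr rfl)
    simp only [dE_apply, LatticeFieldCalculus.grad, ofLp_lapE, hs, ht, sub_self, smul_zero, mul_zero]

/-- `(∂*∂δ)(b) = ⟨∂δ, ∂e_b⟩` (the adjoint curl read at a bond through the unit vector). [cite: Balaban1984PropagatorsII, (2.5) p.224, (2.19) p.226] -/
theorem dcsE_dcE_apply (c : ℝ) (δ : BondSpace P) (b : PBond P 0) :
    (dcsE c (dcE c δ)) b = ⟪dcE c δ, dcE c (EuclideanSpace.single b (1 : ℝ))⟫_ℝ := by
  rw [← inner_dcsE_left, EuclideanSpace.inner_single_right]; simp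

/-- ★ **`∂*∂δ` VANISHES OFF THE PLAQUETTE STENCIL OF `δ`**: if every plaquette through `b` carries no bond of `δ`'s support, `(∂*∂δ)(b) = 0`.
[cite: Balaban1984PropagatorsII, (2.5) p.224, (2.19) p.226] -/
theorem dcsE_dcE_apply_eq_zero_of_not_stencil (c : ℝ) {δ : BondSpace P} {b : PBond P 0}
    (h : ∀ p : Plaq P 0, (b = ⟨p.src, p.μ⟩ ∨ b = ⟨p.src.shift p.μ, p.ν⟩ ∨ b = ⟨p.src.shift p.ν, p.μ⟩ ∨ b = ⟨p.src, p.ν⟩) →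
      δ ⟨p.src, p.μ⟩ = 0 ∧ δ ⟨p.src.shift p.μ, p.ν⟩ = 0 ∧ δ ⟨p.src.shift p.ν, p.μ⟩ = 0 ∧ δ ⟨p.src, p.ν⟩ = 0) :
    (dcsE c (dcE c δ)) b = 0 := by
  rw [dcsE_dcE_apply, inner_eq_sum]
  refine Finset.sum_eq_zero fun p _ => ?_
  by_cases hb : b = ⟨p.src, p.μ⟩ ∨ b = ⟨p.src.shift p.μ, p.ν⟩ ∨ b = ⟨p.src.shift p.ν, p.μ⟩ ∨ b = ⟨p.src, p.ν⟩
  · obtain ⟨h1, h2, h3, h4⟩ := h p hb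
    have h0 : dcE c δ p = 0 := by
      rw [dcE_apply, curl]
      have e1 : (WithLp.ofLp δ) ⟨p.src, p.μ⟩ = 0 := h1
      have e2 : (WithLp.ofLp δ) ⟨p.src.shift p.μ, p.ν⟩ = 0 := h2
      have e3 : (WithLp.ofLp δ) ⟨p.src.shift p.ν, p.μ⟩ = 0 := h3
      have e4 : (WithLp.ofLp δ) ⟨p.src, p.ν⟩ = 0 := h4
      rw [e1, e2, e3, e4]; simp
    rw [h0, zero_mul]
  · simp only [not_or] at hb
    obtain ⟨h1, h2, h3, h4⟩ := hb
    have h0 : dcE c (EuclideanSpace.single b (1 : ℝ)) p = 0 := by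
      rw [dcE_apply, curl, PiLp.ofLp_single]
      simp [Ne.symm h1, Ne.symm h2, Ne.symm h3, Ne.symm h4]
    rw [h0, mul_zero]

/-- ★★ **THE SUPPORT CRITERION**: a fine field `δ` whose PLAQUETTE stencil consists of level-0 cells (every plaquette carrying a bond of `δ`'s support has all four bonds in `Λ₀`) and
whose SITE stencil consists of level-0 cell sites (both ends of every support bond, and their neighbours) has `Δ_aδ = ∂*∂δ + ∂R∂*δ + Q*aQδ ∈ range Q*` — `∂*∂δ` is supported on
level-0 cells, `R∂*δ = 0`, `Q*aQδ` is in the range outright. [cite: Balaban1984PropagatorsII, (2.19) p.226, (2.12) p.225, (2.6) p.224] -/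
theorem deltaAE_mem_range_QsE_of_pinned (c : ℝ) (w : BondIdx D → ℝ) {δ : BondSpace P}
    (hplaq : ∀ p : Plaq P 0, (δ ⟨p.src, p.μ⟩ ≠ 0 ∨ δ ⟨p.src.shift p.μ, p.ν⟩ ≠ 0 ∨ δ ⟨p.src.shift p.ν, p.μ⟩ ≠ 0 ∨ δ ⟨p.src, p.ν⟩ ≠ 0) →
      D.LamBond 0 ⟨p.src, p.μ⟩ ∧ D.LamBond 0 ⟨p.src.shift p.μ, p.ν⟩ ∧ D.LamBond 0 ⟨p.src.shift p.ν, p.μ⟩ ∧ D.LamBond 0 ⟨p.src, p.ν⟩)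
    (hsite : ∀ b, δ b ≠ 0 → ∀ x, (x = b.src ∨ x = b.tgt) → D.LamSite 0 x ∧ ∀ μ, D.LamSite 0 (x.shift μ) ∧ D.LamSite 0 (x.unshift μ)) :
    deltaAE D c w δ ∈ LinearMap.range (QsE D) := by
  rw [deltaAE_def]
  simp only [LinearMap.add_apply, LinearMap.coe_comp, Function.comp_apply]
  refine Submodule.add_mem _ (Submodule.add_mem _ ?_ ?_) (LinearMap.mem_range_self _ _)
  · -- `∂*∂δ` is supported on level-0 cells
    refine mem_range_QsE_of_support_lamBond_zero D _ fun b hb => ?_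
    by_contra hnot
    refine hb (dcsE_dcE_apply_eq_zero_of_not_stencil c fun p hp => ?_)
    by_contra hzero
    have hex : δ ⟨p.src, p.μ⟩ ≠ 0 ∨ δ ⟨p.src.shift p.μ, p.ν⟩ ≠ 0 ∨ δ ⟨p.src.shift p.ν, p.μ⟩ ≠ 0 ∨ δ ⟨p.src, p.ν⟩ ≠ 0 := by
      simp only [not_and_or] at hzero
      exact hzero
    obtain ⟨l1, l2, l3, l4⟩ := hplaq p hex
    rcases hp with rfl | rfl | rfl | rfl
    · exact hnot l1
    · exact hnot l2
    · exact hnot l3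
    · exact hnot l4
  · -- `∂R∂*δ = ∂ 0 = 0`
    rw [RE_dsE_eq_zero_of_pinned_sites D c hsite, map_zero]
    exact Submodule.zero_mem _

/-- ★★★ **THE EXACT PINNED-EXTERIOR LOCALITY IN CONSUMER FORM**: for NODE 00's `flatH P k D` and plain functions `X`, `δ` with `δ`'s plaquette and site stencils made of level-0
cells (the «far pinned» geometry, DISPLAYED), `flatH (X + Qδ) b = flatH X b + δ b` at every fine bond `b` — in particular `flatH (X + Qδ)` and `flatH X` AGREE off `δ`'s support:
the chart may change the constraint datum on far pinned cells (e.g. set it to `0`) without moving `H`'s values anywhere else.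
[cite: Balaban1984PropagatorsII, (2.35) p.228, (2.19)–(2.22) p.226; Balaban1985Variational, (157)–(159) p.302] -/
theorem flatH_add_eq_of_pinned (k : ℕ) (X : BondIdx D → ℝ) (δ : PBond P 0 → ℝ)
    (hplaq : ∀ p : Plaq P 0, (δ ⟨p.src, p.μ⟩ ≠ 0 ∨ δ ⟨p.src.shift p.μ, p.ν⟩ ≠ 0 ∨ δ ⟨p.src.shift p.ν, p.μ⟩ ≠ 0 ∨ δ ⟨p.src, p.ν⟩ ≠ 0) →
      D.LamBond 0 ⟨p.src, p.μ⟩ ∧ D.LamBond 0 ⟨p.src.shift p.μ, p.ν⟩ ∧ D.LamBond 0 ⟨p.src.shift p.ν, p.μ⟩ ∧ D.LamBond 0 ⟨p.src, p.ν⟩)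
    (hsite : ∀ b, δ b ≠ 0 → ∀ x, (x = b.src ∨ x = b.tgt) → D.LamSite 0 x ∧ ∀ μ, D.LamSite 0 (x.shift μ) ∧ D.LamSite 0 (x.unshift μ)) (b : PBond P 0) :
    flatH P k D (X + WithLp.ofLp (QE D (WithLp.toLp 2 δ))) b = flatH P k D X b + δ b :=
  flatH_add_eq P D k X δ (deltaAE_mem_range_QsE_of_pinned D _ _ hplaq hsite) b

/-- The corollary the chart uses verbatim: OFF `δ`'s support the minimiser does not move. [cite: Balaban1985Variational, (157)–(159) p.302; Balaban1984PropagatorsII, (2.35) p.228] -/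
theorem flatH_eq_of_pinned_off_support (k : ℕ) (X : BondIdx D → ℝ) (δ : PBond P 0 → ℝ)
    (hplaq : ∀ p : Plaq P 0, (δ ⟨p.src, p.μ⟩ ≠ 0 ∨ δ ⟨p.src.shift p.μ, p.ν⟩ ≠ 0 ∨ δ ⟨p.src.shift p.ν, p.μ⟩ ≠ 0 ∨ δ ⟨p.src, p.ν⟩ ≠ 0) →
      D.LamBond 0 ⟨p.src, p.μ⟩ ∧ D.LamBond 0 ⟨p.src.shift p.μ, p.ν⟩ ∧ D.LamBond 0 ⟨p.src.shift p.ν, p.μ⟩ ∧ D.LamBond 0 ⟨p.src, p.ν⟩)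
    (hsite : ∀ b, δ b ≠ 0 → ∀ x, (x = b.src ∨ x = b.tgt) → D.LamSite 0 x ∧ ∀ μ, D.LamSite 0 (x.shift μ) ∧ D.LamSite 0 (x.unshift μ))
    {b : PBond P 0} (hb : δ b = 0) :
    flatH P k D (X + WithLp.ofLp (QE D (WithLp.toLp 2 δ))) b = flatH P k D X b := by
  rw [flatH_add_eq_of_pinned D k X δ hplaq hsite b, hb, add_zero]

end Support

/-! ## §4  (v1.1, append-only) The kernel form the head's `H_V Bf b = Σ_c flatH (Pi.single c 1) b • Bf c` consumes -/

section Kernel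

/-- `Q` of the indicator `r·𝟙_{b₀}` of a level-0 cell bond `b₀` that meets no higher index bond's averaging tube is the unit vector `r·𝟙_{⟨0,b₀⟩}` of the index set.
[cite: Balaban1984PropagatorsII, (2.6) p.224, (2.20) p.226] -/
theorem ofLp_QE_single_of_tubeFree {b₀ : PBond P 0} (hb₀ : D.LamBond 0 b₀) (r : ℝ)
    (htube : ∀ i : BondIdx D, i ≠ ⟨⟨⟨0, Nat.succ_pos _⟩, b₀⟩, hb₀⟩ → bondAvgIter (i.1.1 : ℕ) (Pi.single b₀ r) i.1.2 = 0) :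
    WithLp.ofLp (QE D (WithLp.toLp 2 (Pi.single b₀ r))) = Pi.single (⟨⟨⟨0, Nat.succ_pos _⟩, b₀⟩, hb₀⟩ : BondIdx D) r := by
  funext i
  by_cases hi : i = ⟨⟨⟨0, Nat.succ_pos _⟩, b₀⟩, hb₀⟩
  · subst hi
    rw [Pi.single_eq_same]
    show bondAvgIter 0 (Pi.single b₀ r) b₀ = r
    simp [bondAvgIter]
  · rw [Pi.single_eq_of_ne hi]
    exact htube i hi

/-- ★★★ **THE KERNEL OF `H` VANISHES EXACTLY AT FAR PINNED CELLS**: for a level-0 cell bond `b₀` whose plaquette stencil consists of level-0 cells, whose site stencil consists of level-0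
cell sites, and which meets no higher index bond's averaging tube (all three DISPLAYED — in the chart's geometry: `b₀` beyond the one-plaquette ∕ one-site layer of `□₁`'s free region and
beyond the `L`-tubes of the level-1 crossing cells), the kernel column of NODE 00's `flatH` at the index `⟨0, b₀⟩` is the indicator of `b₀`: `flatH (r·𝟙_{⟨0,b₀⟩}) b = 0` for every `b ≠ b₀`
(and `= r` at `b₀`).  Hence in the head's `H_V Bf b = Σ_c flatH (𝟙_c) b • Bf c` the far pinned cells contribute NOTHING to any other bond, whatever `Bf` is there.
[cite: Balaban1984PropagatorsII, (2.35) p.228, (2.19)–(2.22) p.226; Balaban1985Variational, (157)–(159) p.302, (162) p.303] -/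
theorem flatH_single_apply_of_pinned (k : ℕ) {b₀ : PBond P 0} (hb₀ : D.LamBond 0 b₀) (r : ℝ)
    (hplaq : ∀ p : Plaq P 0, (b₀ = ⟨p.src, p.μ⟩ ∨ b₀ = ⟨p.src.shift p.μ, p.ν⟩ ∨ b₀ = ⟨p.src.shift p.ν, p.μ⟩ ∨ b₀ = ⟨p.src, p.ν⟩) →
      D.LamBond 0 ⟨p.src, p.μ⟩ ∧ D.LamBond 0 ⟨p.src.shift p.μ, p.ν⟩ ∧ D.LamBond 0 ⟨p.src.shift p.ν, p.μ⟩ ∧ D.LamBond 0 ⟨p.src, p.ν⟩)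
    (hsite : ∀ x, (x = b₀.src ∨ x = b₀.tgt) → D.LamSite 0 x ∧ ∀ μ, D.LamSite 0 (x.shift μ) ∧ D.LamSite 0 (x.unshift μ))
    (htube : ∀ i : BondIdx D, i ≠ ⟨⟨⟨0, Nat.succ_pos _⟩, b₀⟩, hb₀⟩ → bondAvgIter (i.1.1 : ℕ) (Pi.single b₀ r) i.1.2 = 0) (b : PBond P 0) :
    flatH P k D (Pi.single (⟨⟨⟨0, Nat.succ_pos _⟩, b₀⟩, hb₀⟩ : BondIdx D) r) b = (Pi.single b₀ r : PBond P 0 → ℝ) b := by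
  have hplaq' : ∀ p : Plaq P 0, ((Pi.single b₀ r : PBond P 0 → ℝ) ⟨p.src, p.μ⟩ ≠ 0 ∨ (Pi.single b₀ r : PBond P 0 → ℝ) ⟨p.src.shift p.μ, p.ν⟩ ≠ 0 ∨
      (Pi.single b₀ r : PBond P 0 → ℝ) ⟨p.src.shift p.ν, p.μ⟩ ≠ 0 ∨ (Pi.single b₀ r : PBond P 0 → ℝ) ⟨p.src, p.ν⟩ ≠ 0) →
      D.LamBond 0 ⟨p.src, p.μ⟩ ∧ D.LamBond 0 ⟨p.src.shift p.μ, p.ν⟩ ∧ D.LamBond 0 ⟨p.src.shift p.ν, p.μ⟩ ∧ D.LamBond 0 ⟨p.src, p.ν⟩ := by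
    intro p hp
    refine hplaq p ?_
    have key : ∀ b', (Pi.single b₀ r : PBond P 0 → ℝ) b' ≠ 0 → b₀ = b' := fun b' h => by
      by_contra hne
      exact h (Pi.single_eq_of_ne (M := fun _ : PBond P 0 => ℝ) (Ne.symm hne) r)
    rcases hp with h | h | h | h
    · exact Or.inl (key _ h)
    · exact Or.inr (Or.inl (key _ h))
    · exact Or.inr (Or.inr (Or.inl (key _ h)))
    · exact Or.inr (Or.inr (Or.inr (key _ h)))
  have hsite' : ∀ b', (WithLp.toLp 2 (Pi.single b₀ r) : BondSpace P) b' ≠ 0 → ∀ x, (x = b'.src ∨ x = b'.tgt) →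
      D.LamSite 0 x ∧ ∀ μ, D.LamSite 0 (x.shift μ) ∧ D.LamSite 0 (x.unshift μ) := by
    intro b' hb' x hx
    have hbb : b' = b₀ := by
      by_contra hne
      exact hb' (by show (Pi.single b₀ r : PBond P 0 → ℝ) b' = 0; exact Pi.single_eq_of_ne (M := fun _ : PBond P 0 => ℝ) hne r)
    subst hbb
    exact hsite x hx
  have h := flatH_add_eq_of_pinned D k (0 : BondIdx D → ℝ) (Pi.single b₀ r) hplaq' hsite' b
  rw [zero_add, ofLp_QE_single_of_tubeFree D hb₀ r htube, map_zero, Pi.zero_apply, zero_add] at h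
  exact h

/-- The vanishing form: `flatH (r·𝟙_{⟨0,b₀⟩}) b = 0` for `b ≠ b₀` under the three displayed stencil hypotheses. [cite: Balaban1984PropagatorsII, (2.35) p.228; Balaban1985Variational, (162) p.303] -/
theorem flatH_single_apply_eq_zero_of_pinned (k : ℕ) {b₀ : PBond P 0} (hb₀ : D.LamBond 0 b₀) (r : ℝ)
    (hplaq : ∀ p : Plaq P 0, (b₀ = ⟨p.src, p.μ⟩ ∨ b₀ = ⟨p.src.shift p.μ, p.ν⟩ ∨ b₀ = ⟨p.src.shift p.ν, p.μ⟩ ∨ b₀ = ⟨p.src, p.ν⟩) →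
      D.LamBond 0 ⟨p.src, p.μ⟩ ∧ D.LamBond 0 ⟨p.src.shift p.μ, p.ν⟩ ∧ D.LamBond 0 ⟨p.src.shift p.ν, p.μ⟩ ∧ D.LamBond 0 ⟨p.src, p.ν⟩)
    (hsite : ∀ x, (x = b₀.src ∨ x = b₀.tgt) → D.LamSite 0 x ∧ ∀ μ, D.LamSite 0 (x.shift μ) ∧ D.LamSite 0 (x.unshift μ))
    (htube : ∀ i : BondIdx D, i ≠ ⟨⟨⟨0, Nat.succ_pos _⟩, b₀⟩, hb₀⟩ → bondAvgIter (i.1.1 : ℕ) (Pi.single b₀ r) i.1.2 = 0)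
    {b : PBond P 0} (hb : b ≠ b₀) :
    flatH P k D (Pi.single (⟨⟨⟨0, Nat.succ_pos _⟩, b₀⟩, hb₀⟩ : BondIdx D) r) b = 0 := by
  rw [flatH_single_apply_of_pinned D k hb₀ r hplaq hsite htube b, Pi.single_eq_of_ne hb]

end Kernel

/-! ## §5  (v1.2, append-only) The tube hypothesis from pure geometry: a fine bond far from every `Ω_j^{(j)}`, `j ≥ 1`, meets no higher averaging tube -/

section Tube

open B5Eq118OneStroke (iterBlockOf)
open B6GOmegaMarginV1 (bondAvgIter_eq_zero_of_local)

/-- ★ **THE TUBE HYPOTHESIS `htube` OF §4 FROM GEOMETRY**: if at every level `j ≥ 1` of the family the level-`j` ancestor `y` of `b₀`'s source is not a site of `Ω_j^{(j)}`, no forward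
neighbour `y + e_μ` is, and `y` is no forward neighbour of a site of `Ω_j^{(j)}`, then `b₀` lies in the averaging tube ([4] (1.18)∕(2.20)) of NO index bond other than its own level-0
index: `Q_j(r·𝟙_{b₀})(c) = 0` for every index bond `(j, c) ≠ (0, b₀)` (`B6GOmegaMarginV1.bondAvgIter_eq_zero_of_local`, the block support of `Q_j`).
[cite: Balaban1984PropagatorsI, (1.18) p.20; Balaban1984PropagatorsII, (2.3) p.224, (2.20) p.226] -/
theorem tubeFree_of_far {b₀ : PBond P 0} (hb₀ : D.LamBond 0 b₀)
    (hfar : ∀ j, 1 ≤ j → j ≤ D.k →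
      iterBlockOf j b₀.src ∉ D.Om j ∧ (∀ μ, (iterBlockOf j b₀.src).shift μ ∉ D.Om j) ∧ (∀ z ∈ D.Om j, ∀ μ, z.shift μ ≠ iterBlockOf j b₀.src))
    (r : ℝ) (i : BondIdx D) (hi : i ≠ ⟨⟨⟨0, Nat.succ_pos _⟩, b₀⟩, hb₀⟩) :
    bondAvgIter (i.1.1 : ℕ) (Pi.single b₀ r : PBond P 0 → ℝ) i.1.2 = 0 := by
  obtain ⟨⟨⟨j, hj⟩, c⟩, hc⟩ := i
  by_cases hj0 : j = 0
  · subst hj0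
    have hne : c ≠ b₀ := by
      intro h; subst h; exact hi rfl
    show bondAvgIter 0 (Pi.single b₀ r : PBond P 0 → ℝ) c = 0
    simp [bondAvgIter, Pi.single_eq_of_ne hne]
  · have hj1 : 1 ≤ j := Nat.one_le_iff_ne_zero.mpr hj0
    have hjk : j ≤ D.k := Nat.lt_succ_iff.mp hj
    obtain ⟨hy, hyμ, hz⟩ := hfar j hj1 hjk
    refine bondAvgIter_eq_zero_of_local j (hjk.trans D.hk) _ c fun b' h1 _ => ?_
    by_cases hb : b' = b₀
    · subst hb
      exfalso
      -- `c` is an index bond: one end in `Ω_j^{(j)}`; the ancestor `y` of `b₀.src` is `c.src` or `c.tgt`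
      obtain ⟨hOm, -, -⟩ := hc
      rcases h1 with h | h
      · -- `y = c.src ∉ Ω_j` so `c.tgt = y + e_dir ∈ Ω_j` — excluded
        rcases hOm with hs | ht
        · exact hy (h ▸ hs)
        · exact hyμ c.dir (by rw [h]; exact ht)
      · -- `y = c.tgt = c.src + e_dir`: `c.tgt ∉ Ω_j` so `c.src ∈ Ω_j` — excluded by the third clause
        rcases hOm with hs | ht
        · exact hz c.src hs c.dir h.symm
        · exact hy (h ▸ ht)
    · exact Pi.single_eq_of_ne (M := fun _ : PBond P 0 => ℝ) hb r

/-- ★★★ **THE KERNEL VANISHING FROM GEOMETRY ALONE** (§4 with `htube` discharged by `tubeFree_of_far`): for a level-0 cell bond `b₀` with pinned plaquette and site stencils and far from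
every `Ω_j^{(j)}`, `j ≥ 1`, in the sense of `tubeFree_of_far`, `flatH (r·𝟙_{⟨0,b₀⟩}) b = 0` at every `b ≠ b₀`.
[cite: Balaban1984PropagatorsII, (2.35) p.228, (2.3) p.224; Balaban1985Variational, (162) p.303] -/
theorem flatH_single_apply_eq_zero_of_far (k : ℕ) {b₀ : PBond P 0} (hb₀ : D.LamBond 0 b₀) (r : ℝ)
    (hplaq : ∀ p : Plaq P 0, (b₀ = ⟨p.src, p.μ⟩ ∨ b₀ = ⟨p.src.shift p.μ, p.ν⟩ ∨ b₀ = ⟨p.src.shift p.ν, p.μ⟩ ∨ b₀ = ⟨p.src, p.ν⟩) →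
      D.LamBond 0 ⟨p.src, p.μ⟩ ∧ D.LamBond 0 ⟨p.src.shift p.μ, p.ν⟩ ∧ D.LamBond 0 ⟨p.src.shift p.ν, p.μ⟩ ∧ D.LamBond 0 ⟨p.src, p.ν⟩)
    (hsite : ∀ x, (x = b₀.src ∨ x = b₀.tgt) → D.LamSite 0 x ∧ ∀ μ, D.LamSite 0 (x.shift μ) ∧ D.LamSite 0 (x.unshift μ))
    (hfar : ∀ j, 1 ≤ j → j ≤ D.k →
      iterBlockOf j b₀.src ∉ D.Om j ∧ (∀ μ, (iterBlockOf j b₀.src).shift μ ∉ D.Om j) ∧ (∀ z ∈ D.Om j, ∀ μ, z.shift μ ≠ iterBlockOf j b₀.src))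
    {b : PBond P 0} (hb : b ≠ b₀) :
    flatH P k D (Pi.single (⟨⟨⟨0, Nat.succ_pos _⟩, b₀⟩, hb₀⟩ : BondIdx D) r) b = 0 :=
  flatH_single_apply_eq_zero_of_pinned D k hb₀ r hplaq hsite (tubeFree_of_far D hb₀ hfar r) hb

end Tube

end Summit.QuantumFields.YangMills.Theorems.K0FlatHPinnedExteriorLocality

end
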